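import Summits.Ventures.Crystal3D.Theorems.StickyWulffConstantCoaxialWallLawSharpTransCellPlane
import Summits.Ventures.Crystal3D.Theorems.StickyWulffConstantCoaxialWallLawPayerAssembly
import Summits.Ventures.Crystal3D.Theorems.StickyWulffConstantCoaxialWallLawSkewAxis
import Summits.Ventures.Crystal3D.Theorems.StickyWulffConstantCoaxialWallLawWordTransPlane
import Summits.Ventures.Crystal3D.Theorems.StickyWulffConstantCoaxialWallLawTransGeneric
import HarnessLib

/-!
# Sharp end accounting, translation pairs: the three translation rungs AT THE CRUX'S CONSTANT
# (skew root `α/√2`, skew offset `(√6/4)·sin θ`, generic shift `½`) — modulo the named census facts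

HONEST FRAMING. Part of the venture `Summits/Ventures/Crystal3D` (cell `crystal3d-full`), helper
`--supports` the crux `CoaxialWallLaw` (stmt-Ventures-19481, `route-Ventures-StickyWulffConstant`),
REGISTERED line `WallLedgerF` (planner cf-p1 gen 16), open stub `stub_coaxialTwoSlabAdhesion`.
RUNG CREDIT ONLY (conditional).  The TRANSLATION-pair counterparts (seat 19481-p2) of 19481-p1's
`coaxialTwoSlabAdhesion_general_twin_sharp` (`…SharpTwin`, `√6/4`): the texts of `…ExactTrans` with the cells
replaced by the SHARP ones (`…SharpTransCellPlane`, `…SharpTransCellGeneric`: every reachable end consumes its OWN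
missing contact) and the assembly done by `twoSlab_cross_le_of_deficit` (`…PayerAssembly`) on 19481-p2's deficit
ledger (`…DeficitLedger`).  INPUTS BY NAME: `KissingGap δ` (`δ > 0`, `δ² > 16/3`), the E1 census rows C12-55
(`hcert`) and the A12 glide star (`hcertA`), the k-fold-top census target `KFoldTopDeficit` (`hK`, POSITED in
`…KFoldTop`).  NO `KissingClassification`.

* `translate_twoSlabAdhesion_sharp` — ANY translation pair, a root slot `w` of rise `α = (A₁ w)₂ ≥ 0` whose orthogonal
  slot is skew for the offset: charge `√2 α / 2 = α/√2`.
* `coaxialTwoSlabAdhesion_trans_skew_sharp` — co-axiality data with axis `L e₃` and an offset skew for every non-basal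
  slot: charge `(√6/4)·√(1 − ⟪L e₃, e₃⟫²) = 0.612·sin θ ≥ ½·sin θ` (sharp in-plane slot).
(The 3-adically generic case — orientation-free charge `½` via the steepest slot — is `…SharpTransGeneric`.)

WHAT THIS IS NOT: not the stub unconditionally (the census rows are certified-computation INPUTS, not proved); the
union at `½` is `…HalfUnion`; F-C1 not moved.
-/

noncomputable section

namespace Summit.Ventures.Crystal3D.Theorems

open Summit.Ventures.Crystal3D Finset
open Literature.MathematicalPhysics.StatisticalMechanics (fccStacking barlowStacking IsHaggSeq
  contactDeficiency)
open scoped InnerProductSpace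

section Exact

variable {δ : ℝ} (hg : KissingGap δ) (hδ0 : 0 < δ) (hδ : 16 / 3 < δ ^ 2) (hK : KFoldTopDeficit)
  {s₀ : EuclideanSpace ℝ (Fin 3)} (hs₀ : s₀ ∈ fccSlots)
  (hcert : ExactOnly 0 (fccSlots.filter fun w => 0 < ⟪w, s₀⟫_ℝ))
  (hcertA : ∀ (A : EuclideanSpace ℝ (Fin 3) ≃ₗᵢ[ℝ] EuclideanSpace ℝ (Fin 3)) (n : EuclideanSpace ℝ (Fin 3)),
    ‖n‖ = 1 → (∀ w ∈ fccSlots, ⟪A w, n⟫_ℝ = 0 ∨ ⟪A w, n⟫_ℝ = Real.sqrt (2 / 3) ∨ ⟪A w, n⟫_ℝ = -Real.sqrt (2 / 3)) →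
    ∀ u ∈ fccSlots, ⟪A u, n⟫_ℝ = 0 → ∀ b : EuclideanSpace ℝ (Fin 3),
    ExactOnly b (insert (b - A u)
      (((fccSlots.filter fun s => ⟪s, u⟫_ℝ = -(1 / 2) ∧ ⟪A (u + s), n⟫_ℝ ≤ 0).image (fun s => b + A s)) ∪
        ((fccSlots.filter fun s => ⟪s, u⟫_ℝ = -(1 / 2) ∧ ⟪A (u + s), n⟫_ℝ < 0).image
          (fun s => b + (A s - (2 * ⟪A s, n⟫_ℝ) • n))))))
include hg hδ0 hδ hK hs₀ hcert hcertA

open scoped Classical in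
/-- **The sharp rung for TRANSLATION pairs with a skew-rooted slot** (general fillings, no residual; charge
`√2 (A₁ w)₂/2 = (A₁ w)₂/√2`; census facts by name).  See the module docstring. -/
theorem translate_twoSlabAdhesion_sharp
    (A₁ : EuclideanSpace ℝ (Fin 3) ≃ₗᵢ[ℝ] EuclideanSpace ℝ (Fin 3)) (t₁ : EuclideanSpace ℝ (Fin 3))
    (A₂ : EuclideanSpace ℝ (Fin 3) ≃ₗᵢ[ℝ] EuclideanSpace ℝ (Fin 3)) (t₂ : EuclideanSpace ℝ (Fin 3))
    (htrans : A₁ '' fccStacking 1 (Real.sqrt (2 / 3)) = A₂ '' fccStacking 1 (Real.sqrt (2 / 3)))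
    {w : EuclideanSpace ℝ (Fin 3)} (hw : w ∈ fccSlots) (hα : 0 ≤ (A₁ w) 2)
    {s : EuclideanSpace ℝ (Fin 3)} (hs : s ∈ fccSlots) (hws : ⟪w, s⟫_ℝ = 0)
    (hskew : ∀ z : ℤ, ⟪A₁.symm (t₂ - t₁), s⟫_ℝ ≠ (z : ℝ) / 2) :
    ∃ C R₀ : ℝ, 1 ≤ R₀ ∧ ∀ h : ℝ, 0 ≤ h → ∀ ρ : ℝ, R₀ ≤ ρ →
      ∀ X P₁ P₂ : Finset (EuclideanSpace ℝ (Fin 3)),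
      (∀ p ∈ X, ∀ q ∈ X, p ≠ q → 1 ≤ dist p q) → P₁ ⊆ X → P₂ ⊆ X \ P₁ →
      (∀ p ∈ X, -(2 * R₀) ≤ p 2 ∧ p 2 ≤ h + 2 * R₀ ∧ p 0 ^ 2 + p 1 ^ 2 ≤ ρ ^ 2) →
      (∀ p, p ∈ P₁ ↔ (p ∈ (fun q => A₁ q + t₁) '' fccStacking 1 (Real.sqrt (2 / 3)) ∧
        -(2 * R₀) ≤ p 2 ∧ p 2 ≤ -R₀ ∧ p 0 ^ 2 + p 1 ^ 2 ≤ ρ ^ 2)) →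
      (∀ p, p ∈ P₂ ↔ (p ∈ (fun q => A₂ q + t₂) '' fccStacking 1 (Real.sqrt (2 / 3)) ∧
        h + R₀ ≤ p 2 ∧ p 2 ≤ h + 2 * R₀ ∧ p 0 ^ 2 + p 1 ^ 2 ≤ ρ ^ 2)) →
      ((((P₁ ×ˢ (X \ P₁)).filter fun pq => dist pq.1 pq.2 = 1).card : ℕ) : ℝ) +
        ((((P₂ ×ˢ ((X \ P₁) \ P₂)).filter fun pq => dist pq.1 pq.2 = 1).card : ℕ) : ℝ) ≤
        contactDeficiency ((X \ P₁) \ P₂) +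
          (Real.sqrt 2 / 4 * ∑ᶠ w ∈ {w ∈ fccStacking 1 (Real.sqrt (2 / 3)) | ‖w‖ = 1},
              |⟪w, A₁.symm (EuclideanSpace.single (2 : Fin 3) (1 : ℝ))⟫_ℝ| +
            Real.sqrt 2 / 4 * ∑ᶠ w ∈ {w ∈ fccStacking 1 (Real.sqrt (2 / 3)) | ‖w‖ = 1},
              |⟪w, A₂.symm (EuclideanSpace.single (2 : Fin 3) (1 : ℝ))⟫_ℝ| -
            Real.sqrt 2 * (A₁ w) 2 / 2) * Real.pi * ρ ^ 2 +
          C * (1 + h) * ρ := by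
  -- the top grain in the bottom frame
  have hΛ₂ : (fun q => A₂ q + t₂) '' fccStacking 1 (Real.sqrt (2 / 3)) =
      (fun q => A₁ q + t₂) '' fccStacking 1 (Real.sqrt (2 / 3)) := by
    have e2 : (fun q => A₂ q + t₂) '' fccStacking 1 (Real.sqrt (2 / 3)) =
        (fun y => y + t₂) '' (A₂ '' fccStacking 1 (Real.sqrt (2 / 3))) := by rw [Set.image_image]
    have e1 : (fun q => A₁ q + t₂) '' fccStacking 1 (Real.sqrt (2 / 3)) =
        (fun y => y + t₂) '' (A₁ '' fccStacking 1 (Real.sqrt (2 / 3))) := by rw [Set.image_image]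
    rw [e2, e1, htrans]
  set K : ℝ := 12 * Real.sqrt 2 * Real.pi + 36 * 10 + 55440 with hKdef
  have hK0 : 0 ≤ K := by positivity
  obtain ⟨C, hC⟩ := twoSlab_cross_le_of_deficit A₁ t₁ A₂ t₂ 10 le_rfl
  refine ⟨C + K / 2, 10, by norm_num, ?_⟩
  intro h hh ρ hρ X P₁ P₂ hX hP₁X hP₂X₁ hcyl hP₁ hP₂
  have hP₂X : P₂ ⊆ X := hP₂X₁.trans sdiff_subset
  have hρ0 : (0 : ℝ) ≤ ρ := by linarith
  have hP₂' : ∀ p, p ∈ P₂ ↔ (p ∈ (fun q => A₁ q + t₂) '' fccStacking 1 (Real.sqrt (2 / 3)) ∧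
      h + 10 ≤ p 2 ∧ p 2 ≤ h + 2 * 10 ∧ p 0 ^ 2 + p 1 ^ 2 ≤ ρ ^ 2) := by
    intro p; rw [hP₂, hΛ₂]
  -- the weighted payer bound `√2 α π ρ² − K (1+h) ρ ≤ Σ_window (12 − deg)`
  have hpay : Real.sqrt 2 * (A₁ w) 2 * Real.pi * ρ ^ 2 - K * (1 + h) * ρ ≤
      ∑ z ∈ X.filter (fun z => -(10 : ℝ) - 2 ≤ z 2 ∧ z 2 ≤ h + 10 + 2),
        ((12 : ℝ) - ((X.filter fun q => dist z q = 1).card : ℝ)) := by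
    have hKh : K * ρ ≤ K * (1 + h) * ρ := by
      have := mul_nonneg (mul_nonneg hK0 hh) hρ0; linarith only [this]
    rcases lt_or_eq_of_le hα with hαpos | hα0
    · have hcell := wordNet_trans_payers_ge_plane_sharp hg hδ0 hδ hK hs₀ hcert hcertA A₁ hw hαpos hs hws t₁ t₂ hskew X
        P₁ P₂ 10 h ρ le_rfl hh hρ hX hcyl hP₁X hP₂X hP₁ hP₂'
      rw [← hKdef] at hcell
      linarith only [hcell, hKh]
    · rw [← hα0]
      have : 0 ≤ K * (1 + h) * ρ := by positivity
      have e : Real.sqrt 2 * 0 * Real.pi * ρ ^ 2 = 0 := by ring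
      rw [e]
      refine le_trans (by linarith only [this]) (sum_nonneg fun z _ => ?_)
      have : ((X.filter fun q => dist z q = 1).card : ℝ) ≤ 12 := by
        exact_mod_cast card_filter_dist_eq_one_le_twelve X hX z
      linarith only [this]
  have key := hC h hh ρ hρ X P₁ P₂ hX hP₁X hP₂X₁ hcyl hP₁ hP₂ (Real.sqrt 2 * (A₁ w) 2) K hK0 hpay
  exact key

open scoped Classical in
/-- **The sharp rung for co-axial TRANSLATION pairs with an offset skew to all non-basal slots**, charge
`(√6/4)·sin θ ≥ ½·sin θ` (census facts by name).  See the module docstring. -/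
theorem coaxialTwoSlabAdhesion_trans_skew_sharp
    (A₁ : EuclideanSpace ℝ (Fin 3) ≃ₗᵢ[ℝ] EuclideanSpace ℝ (Fin 3)) (t₁ : EuclideanSpace ℝ (Fin 3))
    (A₂ : EuclideanSpace ℝ (Fin 3) ≃ₗᵢ[ℝ] EuclideanSpace ℝ (Fin 3)) (t₂ : EuclideanSpace ℝ (Fin 3))
    (L : EuclideanSpace ℝ (Fin 3) ≃ₗᵢ[ℝ] EuclideanSpace ℝ (Fin 3)) (s₁ : EuclideanSpace ℝ (Fin 3))
    (σ : ℤ → ℤ) (hσ : IsHaggSeq σ)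
    (hsub₁ : (fun p => A₁ p + t₁) '' fccStacking 1 (Real.sqrt (2 / 3)) ⊆
      (fun p => L p + s₁) '' barlowStacking 1 (Real.sqrt (2 / 3)) σ)
    (htrans : A₁ '' fccStacking 1 (Real.sqrt (2 / 3)) = A₂ '' fccStacking 1 (Real.sqrt (2 / 3)))
    (hskew : ∀ s ∈ fccSlots, ⟪A₁ s, L (EuclideanSpace.single (2 : Fin 3) (1 : ℝ))⟫_ℝ ≠ 0 →
      ∀ z : ℤ, ⟪A₁.symm (t₂ - t₁), s⟫_ℝ ≠ (z : ℝ) / 2) :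
    ∃ C R₀ : ℝ, 1 ≤ R₀ ∧ ∀ h : ℝ, 0 ≤ h → ∀ ρ : ℝ, R₀ ≤ ρ →
      ∀ X P₁ P₂ : Finset (EuclideanSpace ℝ (Fin 3)),
      (∀ p ∈ X, ∀ q ∈ X, p ≠ q → 1 ≤ dist p q) → P₁ ⊆ X → P₂ ⊆ X \ P₁ →
      (∀ p ∈ X, -(2 * R₀) ≤ p 2 ∧ p 2 ≤ h + 2 * R₀ ∧ p 0 ^ 2 + p 1 ^ 2 ≤ ρ ^ 2) →
      (∀ p, p ∈ P₁ ↔ (p ∈ (fun q => A₁ q + t₁) '' fccStacking 1 (Real.sqrt (2 / 3)) ∧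
        -(2 * R₀) ≤ p 2 ∧ p 2 ≤ -R₀ ∧ p 0 ^ 2 + p 1 ^ 2 ≤ ρ ^ 2)) →
      (∀ p, p ∈ P₂ ↔ (p ∈ (fun q => A₂ q + t₂) '' fccStacking 1 (Real.sqrt (2 / 3)) ∧
        h + R₀ ≤ p 2 ∧ p 2 ≤ h + 2 * R₀ ∧ p 0 ^ 2 + p 1 ^ 2 ≤ ρ ^ 2)) →
      ((((P₁ ×ˢ (X \ P₁)).filter fun pq => dist pq.1 pq.2 = 1).card : ℕ) : ℝ) +
        ((((P₂ ×ˢ ((X \ P₁) \ P₂)).filter fun pq => dist pq.1 pq.2 = 1).card : ℕ) : ℝ) ≤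
        contactDeficiency ((X \ P₁) \ P₂) +
          (Real.sqrt 2 / 4 * ∑ᶠ w ∈ {w ∈ fccStacking 1 (Real.sqrt (2 / 3)) | ‖w‖ = 1},
              |⟪w, A₁.symm (EuclideanSpace.single (2 : Fin 3) (1 : ℝ))⟫_ℝ| +
            Real.sqrt 2 / 4 * ∑ᶠ w ∈ {w ∈ fccStacking 1 (Real.sqrt (2 / 3)) | ‖w‖ = 1},
              |⟪w, A₂.symm (EuclideanSpace.single (2 : Fin 3) (1 : ℝ))⟫_ℝ| -
            (Real.sqrt 6 / 4 : ℝ) * Real.sqrt (1 - ⟪L (EuclideanSpace.single (2 : Fin 3) (1 : ℝ)),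
              (EuclideanSpace.single (2 : Fin 3) (1 : ℝ))⟫_ℝ ^ 2)) * Real.pi * ρ ^ 2 +
          C * (1 + h) * ρ := by
  set e₃ : EuclideanSpace ℝ (Fin 3) := EuclideanSpace.single (2 : Fin 3) (1 : ℝ) with he₃
  have he₃1 : ‖e₃‖ = 1 := by rw [he₃, PiLp.norm_single, norm_one]
  have hn1 : ‖L e₃‖ = 1 := by rw [LinearIsometryEquiv.norm_map, he₃1]
  obtain ⟨w, hw, hw0, hwup, hsharp⟩ := exists_inPlane_slot_of_coaxial_sharp A₁ t₁ L s₁ hσ hsub₁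
  obtain ⟨s, hs, hws⟩ := exists_orth_slot hw
  have hmenu := menu_axis_of_coaxial A₁ t₁ L s₁ σ hsub₁
  have hsn : ⟪A₁ s, L e₃⟫_ℝ ≠ 0 := fun hs0 => inner_inPlane_slots_ne_zero A₁ hn1 hmenu hw hs hw0 hs0 hws
  have hα : 0 ≤ (A₁ w) 2 := by rw [apply_two_eq_inner_e₃]; exact hwup
  obtain ⟨C, R₀, hR₀, hmain⟩ := translate_twoSlabAdhesion_sharp hg hδ0 hδ hK hs₀ hcert hcertA A₁ t₁ A₂ t₂ htrans hw hα
    hs hws (hskew s hs hsn)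
  refine ⟨C, R₀, hR₀, ?_⟩
  intro h hh ρ hρ X P₁ P₂ hX hP₁X hP₂X₁ hcyl hP₁ hP₂
  have key := hmain h hh ρ hρ X P₁ P₂ hX hP₁X hP₂X₁ hcyl hP₁ hP₂
  have hw2 : (A₁ w) 2 = ⟪A₁ w, e₃⟫_ℝ := apply_two_eq_inner_e₃ _
  have hflux : Real.sqrt 6 / 4 * Real.sqrt (1 - ⟪L e₃, e₃⟫_ℝ ^ 2) ≤ Real.sqrt 2 * (A₁ w) 2 / 2 := by
    rw [abs_of_nonneg hwup] at hsharp
    rw [hw2]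
    linarith only [hsharp]
  have hπρ : 0 ≤ Real.pi * ρ ^ 2 := by positivity
  have := mul_le_mul_of_nonneg_right hflux hπρ
  linarith only [key, this]

end Exact

end Summit.Ventures.Crystal3D.Theorems

end
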